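import Mathlib
import Summits.NavierStokesRegularity.NavierStokesRegularity.Theorems.TypeIQuarterGateScarEnvelopeTypeISatelliteTowerHullCells
import Summits.NavierStokesRegularity.NavierStokesRegularity.Theorems.TypeIQuarterGateScarEnvelopeTypeISatelliteTowerClosure
import Summits.NavierStokesRegularity.NavierStokesRegularity.Theorems.TypeIQuarterGateScarEnvelopeTypeISatelliteTowerGalleryRecurrence
import Summits.NavierStokesRegularity.NavierStokesRegularity.Theorems.TypeIQuarterGateScarEnvelopeTypeIScarSetTopology
import Summits.NavierStokesRegularity.NavierStokesRegularity.Theorems.RecurrentProfilesRecurrentLiouvillePrBlowupDichotomy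
import Summits.NavierStokesRegularity.NavierStokesRegularity.Theorems.RecurrentProfilesRecurrentLiouvillePrScalingStabilizer
import Summits.NavierStokesRegularity.NavierStokesRegularity.Theorems.SqueezeCycleRecurrentLiouvilleNearIdentityDSS
import Summits.NavierStokesRegularity.NavierStokesRegularity.Theorems.RecurrentProfilesRecurrentReductionOrbit
import Literature.Analysis.FluidPDE.TypeIRateClassicalRepresentative
import Literature.Analysis.FluidPDE.TypeIAncientMildRescale
import Literature.Analysis.FluidPDE.ScalingUniformRecurrence
import Literature.Analysis.FluidPDE.TypeIAncientMildClassical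
import Literature.Analysis.FluidPDE.PineauVicolRSSChaeWolf
import Literature.Analysis.FluidPDE.NSLerayStrongLocalExistence
import Literature.Barriers.NavierStokesRegularity.NearOneDssTypeIExclusion
import Summits.NavierStokesRegularity.NavierStokesRegularity.Theorems.RecurrentProfilesRecurrentLiouvillePrRecurrentHullSymmetric
import Literature.Dynamics.TopologicalDynamics.MinimalOrbitClosure
import Mathlib.Topology.Metrizable.Uniformity
import Summits.NavierStokesRegularity.NavierStokesRegularity.Theorems.ChiralWindowDoorClassDerivDecay

/-!
# Satellite tower for crux `ScarEnvelopeTypeI` (stmt-NavierStokesRegularity-23843) — ROUND-45 Part A: BIRKHOFF ON THE HULL — A1 ★★ a hull point of a uniformly recurrent Type-I singularity model of the Albritton–Barker class is itself uniformly recurrent under scaling (Furstenberg 1.17 + 1.15 in the slab-field model)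

Part A of nsreg-p3 g28's ROUND-45 artefact (section `HullJunction`, re-opened with the artefact's variable block): A1 ★★
`isScalingUniformlyRecurrent_of_hull` — in the `L³_loc` slab-field model the hull of `w` is compact (A–B compactness `exists_orbit_limit`), the scaling
flow is jointly continuous (`stub_prJointContinuity`), so the orbit closure of a uniformly recurrent point is a compact MINIMAL set all of whose points
are uniformly recurrent (`IsUniformlyRecurrentPt.of_mem_closure_orbit_of_isCompact`), read back through `SlabField.isUniformlyRecurrentPt_iff`.
Landing form (25a) of `round-45/ROUND-45.md` §7.

PROVENANCE: declaration texts VERBATIM from the HOME artefact of the instrument seat nsreg-p3 g28 (cell `pub/ns-regularity-ideate`):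
`round-45/Birkhoff45.lean` (sha16 `f8170ff5aabdcd25`, parts `partA45…partD45.lean`; a module written against the TREE, importing route
RecurrentProfiles' crux-1589 dynamics modules and the Literature dynamics BY NAME; its Part Z = ROUND-44 is already in the tree as
`…SatelliteTowerHullJunction/…HullDichotomy/…DssNecklace/…DssCell/…HullCells/…HullEdge`, p664756…p666018), scored by referee ref3
(`SCORE-p3-ROUND-45-0828.md` cba78f676c9340cc, PASS TEXT+LEAN ★★ 21:02:16Z); the author cannot write under `Theorems/` (`perm.theorems-prover-only`); landed by the prover
ns-es-p1 g6 as landing hand of record (director-ns DIRECTOR-NS #237 (3)), split into ≤ 400-line modules, the artefact's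
`#guard_msgs … #print axioms` certificates not landed.  `--supports stmt-NavierStokesRegularity-23843 --as helper`.

HONEST FRAMING: NORMAL FORM / JUNCTION / MECHANISM / METER theorems about HYPOTHETICAL Type-I zoom limits (Albritton–Barker objects of
the census of crux `TypeIQuarterGate.ScarEnvelopeTypeI`, item 23843).  Movement 0 on anything open: item 23843, route TypeIQuarterGate,
crux 1589 `RecurrentLiouville`, crux 22144 `FiniteDissipationLiouville`, the statements (ρ), (θ′), (υ), the DSS cells (τ), (κ), N0 and
Navier–Stokes regularity are all OPEN — NS regularity is NOT proved here.  IN-TREE DISCLOSURE (cited by name, not re-derived):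
Furstenberg 1981 Thms 1.15/1.17 (`Literature/Dynamics/TopologicalDynamics/{UniformRecurrence,MinimalOrbitClosure}.lean`), the `L³_loc`
slab-field model `SlabField` (`Literature/Analysis/FluidPDE/ScalingRecurrentSlabField.lean`), `exists_orbit_limit` (Albritton–Barker
compactness), `stub_prJointContinuity`, `rlNearIdentityDSS_ae_comp_dilation` (route RecurrentProfiles / SqueezeCycle lineage), the PROVED
tree theorem `pineauVicol2026_oneSlice_regularity_holds` (Pineau–Vicol 2026 Thm 1.9) and the KNSS pressure package
`ChiralWindowDoorClassDerivDecay.exists_classical_scaleInvariantBounds_of_class`.  The same two moves exist EARLIER in crux 22144's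
lineage (`FiniteDissipationLiouville.…HullCategoryMinimal.recurrent_of_orbitLimit`, `…Envelope.pv_unsteadiness_floor_of_minimal`) for a
different class; here they are proved independently for the Albritton–Barker class — NOT a new mechanism.
-/

-- the summit-side namespace repeats a component by design (single-conjunct summit, D-0017)
set_option linter.dupNamespace false

open MeasureTheory Set Metric Filter Topology
open scoped ENNReal NNReal InnerProductSpace
open Literature.Analysis.FluidPDE
open Literature.Dynamics.TopologicalDynamics

namespace Summit.NavierStokesRegularity.NavierStokesRegularity.Cruxes.ScarEnvelopeTypeI.ZoomDictionary

section HullJunction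

variable {U U₁ U₂ W : ℝ → (EuclideanSpace ℝ (Fin 3)) → (EuclideanSpace ℝ (Fin 3))}
  {P : ℝ → (EuclideanSpace ℝ (Fin 3)) → ℝ}
  {H : ℝ → (EuclideanSpace ℝ (Fin 3)) → (EuclideanSpace ℝ (Fin 3)) →L[ℝ] (EuclideanSpace ℝ (Fin 3))}
  {M : ℝ}

/-! ## ROUND 45 — Part A.  BIRKHOFF ON THE HULL: a hull point of a uniformly recurrent Type-I
singularity model is itself uniformly recurrent (Furstenberg 1.17 + 1.15 read in the Albritton–Barker
class).

In-tree inputs (disclosed): the abstract dynamics `IsUniformlyRecurrentPt.of_mem_closure_orbit_of_isCompact`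
(`Literature/Dynamics/TopologicalDynamics/MinimalOrbitClosure.lean:130`, Furstenberg 1981 Thms 1.15/1.17),
the slab-field model `SlabField` with its dictionary `SlabField.isUniformlyRecurrentPt_iff` and compact hulls
`SlabField.isCompact_closure_orbit` (`Literature/Analysis/FluidPDE/ScalingRecurrentSlabField.lean:617,631`),
the sequential joint continuity of the scaling flow `stub_prJointContinuity` (p-landed, route RecurrentProfiles)
and the orbit compactness engine `exists_orbit_limit` (`…RecurrentProfilesRecurrentReductionOrbit.lean:276`,
Albritton–Barker 2019 Lemma 2.2 / Prop. 2.3).  New here: the NS-level statement A1 and its census reading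
(Part B). -/

/-- ★★ **A1.  Hull points of a uniformly recurrent singularity model are uniformly recurrent.**
Let `(w, q, G)` be a suitable weak solution on `ℝ³ × ℝ₋` of the Albritton–Barker class (`𝐈 < ∞`, Type-I
time decay `‖w(t,x)‖ ≤ C/√(−t)`, backward-singular origin) which is UNIFORMLY RECURRENT under the scaling
`σ ↦ w_{e^σ}` in `L³_loc`, and let `U ∈ L³_loc` be ANY point of its scaling hull: `w_{l_k} → U` in every
`L³(Q(0,R))` along some scales `l_k > 0`.  Then `U` is uniformly recurrent under scaling.
Proof: in the slab-field model the hull of `w` is compact (A–B compactness, `exists_orbit_limit`), the flow is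
jointly continuous (`stub_prJointContinuity`) and the space is pseudo-metrisable hence regular; the orbit
closure of a uniformly recurrent point is then a compact MINIMAL set all of whose points are uniformly
recurrent (Furstenberg 1.17 + 1.15, `IsUniformlyRecurrentPt.of_mem_closure_orbit_of_isCompact`); read back
through the dictionary `SlabField.isUniformlyRecurrentPt_iff`. -/
theorem isScalingUniformlyRecurrent_of_hull
    {w : ℝ → (EuclideanSpace ℝ (Fin 3)) → (EuclideanSpace ℝ (Fin 3))} {q : ℝ → (EuclideanSpace ℝ (Fin 3)) → ℝ}
    {G : ℝ → (EuclideanSpace ℝ (Fin 3)) → (EuclideanSpace ℝ (Fin 3)) →L[ℝ] (EuclideanSpace ℝ (Fin 3))}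
    (hsw : IsSuitableWeakSolutionOn (slab (EuclideanSpace ℝ (Fin 3)) (Iio 0) isOpen_Iio) 1 0 w q)
    (hwg : HasWeakSpatialGradientOn (slab (EuclideanSpace ℝ (Fin 3)) (Iio 0) isOpen_Iio) w G)
    (hI : typeIBound (Iio (0 : ℝ) ×ˢ univ) w q G < ⊤) {C : ℝ} (hdec : HasTypeITimeDecay C w)
    (hsing : IsBackwardSingularPoint w 0) (hrec : IsScalingUniformlyRecurrent w)
    {U : ℝ → (EuclideanSpace ℝ (Fin 3)) → (EuclideanSpace ℝ (Fin 3))}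
    (hU : ∀ R : ℝ, 0 < R → MemLp (Function.uncurry U) 3
      (volume.restrict (parabolicCylinder R (0 : ℝ × (EuclideanSpace ℝ (Fin 3))))))
    {l : ℕ → ℝ} (hl : ∀ k, 0 < l k)
    (hlim : ∀ R : ℝ, 0 < R → Tendsto (fun k => eLpNorm
      (Function.uncurry (nsRescale (l k) w) - Function.uncurry U) 3
      (volume.restrict (parabolicCylinder R (0 : ℝ × (EuclideanSpace ℝ (Fin 3)))))) atTop (𝓝 0)) :
    IsScalingUniformlyRecurrent U := by
  classical
  haveI h13 : Fact (1 ≤ (3 : ℝ≥0∞)) := ⟨by norm_num⟩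
  -- ## the model: `w` and `U` as points of the `L³_loc` slab-field space
  let x₀ : SlabField (EuclideanSpace ℝ (Fin 3)) (EuclideanSpace ℝ (Fin 3)) 3 :=
    SlabField.ofMemLp w fun R hR => Summit.NavierStokesRegularity.NavierStokesRegularity.Theorems.memLp_three_of_slabProfile hwg hI hR
  let z : SlabField (EuclideanSpace ℝ (Fin 3)) (EuclideanSpace ℝ (Fin 3)) 3 := SlabField.ofMemLp U hU
  -- ## compactness of the hull of `w` (Albritton–Barker compactness fed to the model)
  have hScpt : IsCompact (closure (range fun σ => SlabField.flow σ x₀)) :=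
    x₀.isCompact_closure_orbit fun σs => by
      obtain ⟨u', p', H', ψ, hψ, -, hwg', hI', -, -, hconv'⟩ :=
        Summit.NavierStokesRegularity.NavierStokesRegularity.Theorems.exists_orbit_limit hsw hwg hI hsing hdec
          (fun k => Real.exp (σs k)) (fun k => Real.exp_pos _)
      have hI'' : typeIBound (Iio (0 : ℝ) ×ˢ univ) u' p' H' < ⊤ :=
        lt_of_le_of_lt hI' (ENNReal.mul_lt_top (by simp) hI)
      refine ⟨SlabField.ofMemLp u' fun R hR =>
        Summit.NavierStokesRegularity.NavierStokesRegularity.Theorems.memLp_three_of_slabProfile hwg' hI'' hR,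
        ψ, hψ, ?_⟩
      rw [SlabField.tendsto_flow_iff_forall]
      exact hconv'
  -- ## the scaling flow is JOINTLY continuous (sequentially, `stub_prJointContinuity`)
  have hjoint : Continuous fun p : ℝ × SlabField (EuclideanSpace ℝ (Fin 3)) (EuclideanSpace ℝ (Fin 3)) 3 =>
      SlabField.flow p.1 p.2 := by
    refine continuous_iff_seqContinuous.2 fun x a hxa => ?_
    have h1 : Tendsto (fun k => (x k).1) atTop (𝓝 a.1) := hxa.fst_nhds
    have h2 := (SlabField.tendsto_iff_forall _ _).1 hxa.snd_nhds
    show Tendsto (fun k => SlabField.flow (x k).1 (x k).2) atTop (𝓝 (SlabField.flow a.1 a.2))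
    rw [SlabField.tendsto_iff_forall]
    intro R' hR'
    exact Summit.NavierStokesRegularity.NavierStokesRegularity.Theorems.stub_prJointContinuity
      (fun k => ((x k).2).toFun) a.2.toFun
      (fun k R hR => ((x k).2).memLp R) (fun R hR => a.2.memLp R) h2 (fun k => Real.exp (x k).1)
      (Real.exp a.1) (fun k => Real.exp_pos _) (Real.exp_pos _)
      ((Real.continuous_exp.tendsto _).comp h1) R' hR'
  -- ## `x₀` is a uniformly recurrent point of the flow (dictionary)
  have hrecpt : IsUniformlyRecurrentPt
      (SlabField.flow (E := EuclideanSpace ℝ (Fin 3)) (F := EuclideanSpace ℝ (Fin 3)) (p := 3)) x₀ :=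
    (SlabField.isUniformlyRecurrentPt_iff x₀).2 hrec
  -- ## `z` lies in the hull of `x₀`
  have hz : z ∈ closure (range fun σ => SlabField.flow σ x₀) := by
    refine mem_closure_of_tendsto (f := fun k => SlabField.flow (Real.log (l k)) x₀) (b := atTop) ?_
      (Eventually.of_forall fun k => ⟨Real.log (l k), rfl⟩)
    rw [SlabField.tendsto_iff_forall]
    intro R' hR'
    refine (hlim R' hR').congr fun k => ?_
    rw [SlabField.flow_log_toFun (hl k)]
    rfl
  -- ## Furstenberg 1.17 + 1.15: every point of the compact minimal hull is uniformly recurrent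
  have hzpt : IsUniformlyRecurrentPt
      (SlabField.flow (E := EuclideanSpace ℝ (Fin 3)) (F := EuclideanSpace ℝ (Fin 3)) (p := 3)) z :=
    hrecpt.of_mem_closure_orbit_of_isCompact hjoint SlabField.flow_add hScpt hz
  exact (SlabField.isUniformlyRecurrentPt_iff z).1 hzpt

end HullJunction

end Summit.NavierStokesRegularity.NavierStokesRegularity.Cruxes.ScarEnvelopeTypeI.ZoomDictionary
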